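/-
Copyright (c) 2026 the pub-hodgecm-mathlib formalisation cell (harness21).  Prover seat hodgecm-mathlib-A-p16 (g33): road «S3-ram» (LEAD F0P3a-plan (g13); owner lineage
F0P3a-p06), the (Cnt2′) BLOCK-LAW skeleton (keeper F0P3a-p06 (g16), chair F0P3a-p07 (g15) RULING (13)(5)(6)): composition pen `stub_Zaniso`, FILE Z2 — THE ROOT'S COLLAR
CENSUS TRANSPORTS ALONG A FRAME `M ↦ P·M`, `Γ ↦ P Γ P⁻¹`; 2026-09-02.
-/
import Literature.NumberTheory.Automorphic.UnitaryLatticeTreeFormTransport      -- ★ `exists_iso_latticeGraph_formCongr`, `map_conj_sub_one[_sq]_le_scaleLattice_iff`, `exists_mem_mapGL_class_iff`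
import Literature.NumberTheory.Automorphic.UnitaryLatticeTreeFrameChange       -- ★ `mapGL_conj_mapGL_eq_iff`
import Literature.Combinatorics.SimpleGraph.TreeDescendantPartition            -- ★ J3 `dist_iso_apply`, `ncard_image_iso`
import HarnessLib

/-!
# The lattice graph of a hermitian space — THE ROOT'S COLLAR CENSUS TRANSPORTS ALONG A FRAME: `#{labelled fixed grandchildren of r in the J-tree under PΓP⁻¹}
# = #{labelled fixed grandchildren of r♭ in the ᵗσ(P)JP-tree under Γ}` (Bruhat–Tits 1972 §10; Kottwitz 1986 §3; Serre 1980 II.1.1)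

Topic `NumberTheory/Automorphic`; namespace `Literature.NumberTheory.Automorphic.UnitaryLatticeTree`.  THEOREMS ONLY (no definition, no instance, no notation, no named fact,
no `sorry`); kernel lane `--supports stmt-HodgeConjecture-24833`; datum-free (`K` with `Valued K ℤᵐ⁰`, any ring endomorphism `σ`, any `ϖ`, any form `J`, any `P ∈ GL_N(K)`).
Cell `pub/hodgecm-mathlib` (D-0151), crux H413; road «S3-ram» (Literature seeding, count-neutral); the (Cnt2′) BLOCK-LAW skeleton of keeper F0P3a-p06 (g16), cells
`stub_Zaniso_*` (composition pen A-p16 (g33)): the census suppliers (organ (5): F0P2-p01 (g16) (L1)(L2), F0P3a-p04 (g20), F0P3a-p02 (g18)) count the labelled collar of the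
root `L₀ = 𝒪³` in the BLOCK model (`H♭ = ι-shape(diag d, η)`, element `Γ = ι(γ₁, u)`), while the ★ route-B singleton heads (p848877 ∕ p848995 ∕ p849100) consume the same
counts in the `Φ₃ = J`-model at the conjugated literal `γ′ = P₁ Γ P₁⁻¹` — their census binders `hNE ∕ hNO ∕ hNP ∕ hNM` are `Set.ncard`s of «vertices `x` two steps below the root
through a `γ′`-fixed child, `γ′`-fixed, with a LABEL (level ∕ square-level ∕ class tokens of `x.1` for `γ′`)».  THIS FILE moves such counts between the two models.

THE MATHEMATICS ([BruhatTits1972] §10; [Serre1980Trees] II.1.1; [Kottwitz1986] §3).  For `P ∈ GL_N(K)` the map `M ↦ P·M` is an isomorphism of lattice graphs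
`latticeGraph σ ϖ (ᵗσ(P)JP) ≃g latticeGraph σ ϖ J` (★ `exists_iso_latticeGraph_formCongr`); it carries the root `r♭` to `r` when `r = P·r♭`, preserves adjacency and graph
distance (★ `dist_iso_apply`), carries `Γ`-fixed vertices to `PΓP⁻¹`-fixed vertices (★ `mapGL_conj_mapGL_eq_iff`), and carries any lattice label `Q₂` to a label `Q₁` with
`Q₁(P·M) ↔ Q₂(M)` — for the route-B labels this is ★ `map_conj_sub_one_le_scaleLattice_iff` (level), ★ `map_conj_sub_one_sq_le_scaleLattice_iff` (square level), ★
`exists_mem_mapGL_class_iff` (class, the form moving to `ᵗσ(P)JP`).  Hence the labelled-collar sets correspond under the isomorphism and have the same `Set.ncard`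
(★ `ncard_image_iso`).
* §1 **`ncard_rootGrandchildren_sep_eq_of_formCongr`** — the structural transport for an ARBITRARY label pair `(Q₁, Q₂)` with `∀ M, Q₁ (mapGL P M) ↔ Q₂ M`; root, forms and
  elements quantified (`hHb : formCongr σ P J = H♭`, `hγ : ↑γ′ = P·↑Γ·P⁻¹`, `hr : r.1 = mapGL P r♭.1`), so every supplier's own vertex term for the root is accepted.
* §2 the SEVEN route-B labels: `ncard_rootGrandchildren_{E,P,M}_eq_of_formCongr` (odd root depth `d₀`: `E = ¬LEV(ϖ^d₀) ∧ LEV(ϖ^(d₀−1)) ∧ ¬LEV(ϖ^d₀)`… VERBATIM the census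
  binders of ★ p848877) and `ncard_rootGrandchildren_{Eeven,O,Peven,Meven}_eq_of_formCongr` (even root depth, ★ p848995's binders), each = §1 with `hQ` discharged by ★ §4 of
  `UnitaryLatticeTreeFormTransport`.
HONEST LABEL: HC_CM is proved only modulo the 2 remaining named inputs (hLiu418 24832, h413 24833) until rung 0 closes; nothing printed is asserted here (bookkeeping between two
models of one tree); «S3-ram» has no books consequence.

## References
* [BruhatTits1972] F. Bruhat, J. Tits, *Groupes réductifs sur un corps local I*, Publ. Math. IHÉS 41 (1972), §10 (the lattice model of the building; functoriality in the form).
* [Serre1980Trees] J.-P. Serre, *Trees* (1980), Ch. II §1.1 (lattices, the tree, the action of `GL_N`), Ch. I §2.3 (distance), §6.4 Prop. 24 (fixed points under conjugation).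
* [Kottwitz1986] R. E. Kottwitz, *Base change for unit elements of Hecke algebras*, Compositio Math. 60 (1986), §3 (counting labelled fixed lattices in a convenient basis).
* [Rogawski1990] J. D. Rogawski, *Automorphic Representations of Unitary Groups in Three Variables*, Ann. of Math. Stud. 123 (1990), §4.9 Lemma 4.9.3 (labels of fixed lattices).
-/

set_option autoImplicit false

noncomputable section

open scoped Valued WithZero Matrix MatrixGroups
open Literature.Combinatorics.SimpleGraph.TreeLayers

namespace Literature.NumberTheory.Automorphic.UnitaryLatticeTree

open Literature.NumberTheory.Automorphic Literature.NumberTheory.Automorphic.HermitianLattice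

variable {K : Type*} [Field K] [Valued K ℤᵐ⁰] {N : ℕ} {σ : K →+* K} {ϖ : K}

/-! ## §1 The structural transport: labelled fixed grandchildren of the root -/

/-- **THE ROOT'S LABELLED COLLAR TRANSPORTS ALONG A FRAME.**  `J` a form, `P ∈ GL_N(K)`, `H♭ = ᵗσ(P)JP` (`hHb`), `Γ ∈ U(σ, H♭)` and `γ′ ∈ U(σ, J)` with `↑γ′ = P·↑Γ·P⁻¹`
(`hγ`), roots `r` (of the `J`-tree) and `r♭` (of the `H♭`-tree) with `r = P·r♭` (`hr`), and two lattice labels with `Q₁(P·M) ↔ Q₂(M)` (`hQ`): the number of `γ′`-fixed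
vertices two steps below `r` through a `γ′`-fixed child and carrying `Q₁` equals the number of `Γ`-fixed vertices two steps below `r♭` through a `Γ`-fixed child and
carrying `Q₂` — the first set is the image of the second under the graph isomorphism `M ↦ P·M` (★ `exists_iso_latticeGraph_formCongr`; distances ★ `dist_iso_apply`;
fixedness ★ `mapGL_conj_mapGL_eq_iff`; count ★ `ncard_image_iso`).  The two set-builders are the census binders of the route-B heads ★ p848877 ∕ p848995 with the label
abstracted. [cite: BruhatTits1972, §10] [cite: Serre1980Trees, Ch. II §1.1, Ch. I §6.4 Prop. 24] [cite: Kottwitz1986, §3] -/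
theorem ncard_rootGrandchildren_sep_eq_of_formCongr (J : Matrix (Fin N) (Fin N) K) (P : GL (Fin N) K) {Hb : Matrix (Fin N) (Fin N) K} (hHb : formCongr σ P J = Hb)
    (γ' : unitaryGroupOfForm σ J) (Γ : unitaryGroupOfForm σ Hb) (hγ : (γ' : GL (Fin N) K) = P * (Γ : GL (Fin N) K) * P⁻¹)
    (r : {M : Submodule 𝒪[K] (Fin N → K) // IsVertex σ ϖ J M}) (rb : {M : Submodule 𝒪[K] (Fin N → K) // IsVertex σ ϖ Hb M}) (hr : r.1 = mapGL P rb.1)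
    (Q₁ Q₂ : Submodule 𝒪[K] (Fin N → K) → Prop) (hQ : ∀ M, Q₁ (mapGL P M) ↔ Q₂ M) :
    {x : {M : Submodule 𝒪[K] (Fin N → K) // IsVertex σ ϖ J M} | x ∈ {x : {M : Submodule 𝒪[K] (Fin N → K) // IsVertex σ ϖ J M} | ∃ c, ((latticeGraph σ ϖ J).Adj r c ∧ (latticeGraph σ ϖ J).dist r c = (latticeGraph σ ϖ J).dist r r + 1 ∧ latticeGraphIso σ ϖ J γ' c = c) ∧ ((latticeGraph σ ϖ J).Adj c x ∧ (latticeGraph σ ϖ J).dist r x = (latticeGraph σ ϖ J).dist r c + 1 ∧ latticeGraphIso σ ϖ J γ' x = x)} ∧ Q₁ x.1}.ncard =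
      {x : {M : Submodule 𝒪[K] (Fin N → K) // IsVertex σ ϖ Hb M} | x ∈ {x : {M : Submodule 𝒪[K] (Fin N → K) // IsVertex σ ϖ Hb M} | ∃ c, ((latticeGraph σ ϖ Hb).Adj rb c ∧ (latticeGraph σ ϖ Hb).dist rb c = (latticeGraph σ ϖ Hb).dist rb rb + 1 ∧ latticeGraphIso σ ϖ Hb Γ c = c) ∧ ((latticeGraph σ ϖ Hb).Adj c x ∧ (latticeGraph σ ϖ Hb).dist rb x = (latticeGraph σ ϖ Hb).dist rb c + 1 ∧ latticeGraphIso σ ϖ Hb Γ x = x)} ∧ Q₂ x.1}.ncard := by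
  subst hHb
  obtain ⟨φ, hφ⟩ := exists_iso_latticeGraph_formCongr σ ϖ J P
  -- the root, the fixedness and the label under `φ`
  have hφr : φ rb = r := Subtype.ext (by rw [hφ, ← hr])
  have hfix : ∀ v, latticeGraphIso σ ϖ J γ' (φ v) = φ v ↔ latticeGraphIso σ ϖ (formCongr σ P J) Γ v = v := fun v => by
    rw [Subtype.ext_iff, Subtype.ext_iff, latticeGraphIso_apply_coe, latticeGraphIso_apply_coe, hφ]
    change mapGL (γ' : GL (Fin N) K) (mapGL P v.1) = mapGL P v.1 ↔ mapGL (Γ : GL (Fin N) K) v.1 = v.1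
    rw [hγ, mapGL_conj_mapGL_eq_iff]
  have hlab : ∀ v, Q₁ (φ v).1 ↔ Q₂ v.1 := fun v => by rw [hφ]; exact hQ v.1
  -- the set on the `J`-side is the image of the set on the `H♭`-side
  have himage : {x : {M : Submodule 𝒪[K] (Fin N → K) // IsVertex σ ϖ J M} | x ∈ {x : {M : Submodule 𝒪[K] (Fin N → K) // IsVertex σ ϖ J M} | ∃ c, ((latticeGraph σ ϖ J).Adj r c ∧ (latticeGraph σ ϖ J).dist r c = (latticeGraph σ ϖ J).dist r r + 1 ∧ latticeGraphIso σ ϖ J γ' c = c) ∧ ((latticeGraph σ ϖ J).Adj c x ∧ (latticeGraph σ ϖ J).dist r x = (latticeGraph σ ϖ J).dist r c + 1 ∧ latticeGraphIso σ ϖ J γ' x = x)} ∧ Q₁ x.1} =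
      φ '' {x : {M : Submodule 𝒪[K] (Fin N → K) // IsVertex σ ϖ (formCongr σ P J) M} | x ∈ {x : {M : Submodule 𝒪[K] (Fin N → K) // IsVertex σ ϖ (formCongr σ P J) M} | ∃ c, ((latticeGraph σ ϖ (formCongr σ P J)).Adj rb c ∧ (latticeGraph σ ϖ (formCongr σ P J)).dist rb c = (latticeGraph σ ϖ (formCongr σ P J)).dist rb rb + 1 ∧ latticeGraphIso σ ϖ (formCongr σ P J) Γ c = c) ∧ ((latticeGraph σ ϖ (formCongr σ P J)).Adj c x ∧ (latticeGraph σ ϖ (formCongr σ P J)).dist rb x = (latticeGraph σ ϖ (formCongr σ P J)).dist rb c + 1 ∧ latticeGraphIso σ ϖ (formCongr σ P J) Γ x = x)} ∧ Q₂ x.1} := by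
    ext x
    simp only [Set.mem_setOf_eq, Set.mem_image]
    constructor
    · rintro ⟨⟨c, ⟨hrc, hdc, hfc⟩, hcx, hdx, hfx⟩, hQx⟩
      refine ⟨φ.symm x, ⟨⟨φ.symm c, ⟨?_, ?_, ?_⟩, ?_, ?_, ?_⟩, ?_⟩, RelIso.apply_symm_apply φ x⟩
      · have h := φ.symm.map_adj_iff.2 hrc
        rwa [← hφr, RelIso.symm_apply_apply] at h
      · rw [← dist_iso_apply φ, ← dist_iso_apply φ rb rb, RelIso.apply_symm_apply, hφr]; exact hdc
      · rw [← hfix, RelIso.apply_symm_apply]; exact hfc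
      · exact φ.symm.map_adj_iff.2 hcx
      · rw [← dist_iso_apply φ, ← dist_iso_apply φ rb, RelIso.apply_symm_apply, RelIso.apply_symm_apply, hφr]; exact hdx
      · rw [← hfix, RelIso.apply_symm_apply]; exact hfx
      · rw [← hlab, RelIso.apply_symm_apply]; exact hQx
    · rintro ⟨v, ⟨⟨c, ⟨hrc, hdc, hfc⟩, hcv, hdv, hfv⟩, hQv⟩, rfl⟩
      refine ⟨⟨φ c, ⟨?_, ?_, ?_⟩, ?_, ?_, ?_⟩, ?_⟩
      · rw [← hφr]; exact φ.map_adj_iff.2 hrc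
      · rw [← hφr, dist_iso_apply, dist_iso_apply]; exact hdc
      · exact (hfix c).2 hfc
      · exact φ.map_adj_iff.2 hcv
      · rw [← hφr, dist_iso_apply, dist_iso_apply]; exact hdv
      · exact (hfix v).2 hfv
      · exact (hlab v).2 hQv
  rw [himage, ncard_image_iso]


/-! ## §2 The seven route-B labels (odd root depth: `E`, `P`, `M` of ★ p848877; even root depth: `E`, `O`, `P`, `M` of ★ p848995) -/

/-- The route-B census atom **`E`** (odd root depth `d₀`; the `hNE` binder of ★ p848877 with the label VERBATIM) transports along the frame (§1 with `hQ` from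
★ `map_conj_sub_one_le_scaleLattice_iff` ∕ `map_conj_sub_one_sq_le_scaleLattice_iff` ∕ `exists_mem_mapGL_class_iff`). [cite: Kottwitz1986, §3] [cite: BruhatTits1972, §10] -/
theorem ncard_rootGrandchildren_E_eq_of_formCongr (J : Matrix (Fin 3) (Fin 3) K) (P : GL (Fin 3) K) {Hb : Matrix (Fin 3) (Fin 3) K} (hHb : formCongr σ P J = Hb)
    (γ' : unitaryGroupOfForm σ J) (Γ : unitaryGroupOfForm σ Hb) (hγ : (γ' : GL (Fin 3) K) = P * (Γ : GL (Fin 3) K) * P⁻¹)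
    (r : {M : Submodule 𝒪[K] (Fin 3 → K) // IsVertex σ ϖ J M}) (rb : {M : Submodule 𝒪[K] (Fin 3 → K) // IsVertex σ ϖ Hb M}) (hr : r.1 = mapGL P rb.1)
    {d₀ : ℕ} :
    ({w | w ∈ {w | ∃ c, ((latticeGraph σ ϖ J).Adj r c ∧ (latticeGraph σ ϖ J).dist r c = (latticeGraph σ ϖ J).dist r r + 1 ∧ latticeGraphIso σ ϖ J γ' c = c) ∧ ((latticeGraph σ ϖ J).Adj c w ∧ (latticeGraph σ ϖ J).dist r w = (latticeGraph σ ϖ J).dist r c + 1 ∧ latticeGraphIso σ ϖ J γ' w = w)} ∧ (¬ w.1.map ((Matrix.toLin' (((γ' : GL (Fin 3) K) : Matrix (Fin 3) (Fin 3) K) - 1)).restrictScalars 𝒪[K]) ≤ scaleLattice (ϖ ^ d₀) w.1 ∧ (w.1.map ((Matrix.toLin' (((γ' : GL (Fin 3) K) : Matrix (Fin 3) (Fin 3) K) - 1)).restrictScalars 𝒪[K]) ≤ scaleLattice (ϖ ^ (d₀ - 1)) w.1 ∧ ¬ w.1.map ((Matrix.toLin' (((γ' : GL (Fin 3) K) :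 Matrix (Fin 3) (Fin 3) K) - 1)).restrictScalars 𝒪[K]) ≤ scaleLattice (ϖ ^ d₀) w.1))}).ncard =
      ({w | w ∈ {w | ∃ c, ((latticeGraph σ ϖ Hb).Adj rb c ∧ (latticeGraph σ ϖ Hb).dist rb c = (latticeGraph σ ϖ Hb).dist rb rb + 1 ∧ latticeGraphIso σ ϖ Hb Γ c = c) ∧ ((latticeGraph σ ϖ Hb).Adj c w ∧ (latticeGraph σ ϖ Hb).dist rb w = (latticeGraph σ ϖ Hb).dist rb c + 1 ∧ latticeGraphIso σ ϖ Hb Γ w = w)} ∧ (¬ w.1.map ((Matrix.toLin' (((Γ : GL (Fin 3) K) : Matrix (Fin 3) (Fin 3) K) - 1)).restrictScalars 𝒪[K]) ≤ scaleLattice (ϖ ^ d₀) w.1 ∧ (w.1.map ((Matrix.toLin' (((Γ : GL (Fin 3) K) : Matrix (Fin 3) (Fin 3) K) - 1)).restrictScalars 𝒪[K]) ≤ scaleLattice (ϖ ^ (d₀ - 1)) w.1 ∧ ¬ w.1.map ((Matrix.toLin' (((Γ : GL (Fin 3) K) : Matrix (Fin 3) (Fin 3) K) - 1)).restrictScalars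 𝒪[K]) ≤ scaleLattice (ϖ ^ d₀) w.1))}).ncard := by
  refine ncard_rootGrandchildren_sep_eq_of_formCongr J P hHb γ' Γ hγ r rb hr
    (fun M => (¬ M.map ((Matrix.toLin' (((γ' : GL (Fin 3) K) : Matrix (Fin 3) (Fin 3) K) - 1)).restrictScalars 𝒪[K]) ≤ scaleLattice (ϖ ^ d₀) M ∧ (M.map ((Matrix.toLin' (((γ' : GL (Fin 3) K) : Matrix (Fin 3) (Fin 3) K) - 1)).restrictScalars 𝒪[K]) ≤ scaleLattice (ϖ ^ (d₀ - 1)) M ∧ ¬ M.map ((Matrix.toLin' (((γ' : GL (Fin 3) K) : Matrix (Fin 3) (Fin 3) K) - 1)).restrictScalars 𝒪[K]) ≤ scaleLattice (ϖ ^ d₀) M)))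
    (fun M => (¬ M.map ((Matrix.toLin' (((Γ : GL (Fin 3) K) : Matrix (Fin 3) (Fin 3) K) - 1)).restrictScalars 𝒪[K]) ≤ scaleLattice (ϖ ^ d₀) M ∧ (M.map ((Matrix.toLin' (((Γ : GL (Fin 3) K) : Matrix (Fin 3) (Fin 3) K) - 1)).restrictScalars 𝒪[K]) ≤ scaleLattice (ϖ ^ (d₀ - 1)) M ∧ ¬ M.map ((Matrix.toLin' (((Γ : GL (Fin 3) K) : Matrix (Fin 3) (Fin 3) K) - 1)).restrictScalars 𝒪[K]) ≤ scaleLattice (ϖ ^ d₀) M))) fun M => ?_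
  subst hHb
  simp only [hγ, map_conj_sub_one_le_scaleLattice_iff]

/-- The route-B census atom **`P`** (odd root depth `d₀`; the `hNP` binder of ★ p848877 with the label VERBATIM) transports along the frame (§1 with `hQ` from
★ `map_conj_sub_one_le_scaleLattice_iff` ∕ `map_conj_sub_one_sq_le_scaleLattice_iff` ∕ `exists_mem_mapGL_class_iff`). [cite: Kottwitz1986, §3] [cite: BruhatTits1972, §10] -/
theorem ncard_rootGrandchildren_P_eq_of_formCongr (J : Matrix (Fin 3) (Fin 3) K) (P : GL (Fin 3) K) {Hb : Matrix (Fin 3) (Fin 3) K} (hHb : formCongr σ P J = Hb)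
    (γ' : unitaryGroupOfForm σ J) (Γ : unitaryGroupOfForm σ Hb) (hγ : (γ' : GL (Fin 3) K) = P * (Γ : GL (Fin 3) K) * P⁻¹)
    (r : {M : Submodule 𝒪[K] (Fin 3 → K) // IsVertex σ ϖ J M}) (rb : {M : Submodule 𝒪[K] (Fin 3 → K) // IsVertex σ ϖ Hb M}) (hr : r.1 = mapGL P rb.1)
    {d₀ : ℕ} (c₁ : K) :
    ({w | w ∈ {w | ∃ c, ((latticeGraph σ ϖ J).Adj r c ∧ (latticeGraph σ ϖ J).dist r c = (latticeGraph σ ϖ J).dist r r + 1 ∧ latticeGraphIso σ ϖ J γ' c = c) ∧ ((latticeGraph σ ϖ J).Adj c w ∧ (latticeGraph σ ϖ J).dist r w = (latticeGraph σ ϖ J).dist r c + 1 ∧ latticeGraphIso σ ϖ J γ' w = w)} ∧ (¬ w.1.map ((Matrix.toLin' (((γ' : GL (Fin 3) K) : Matrix (Fin 3) (Fin 3) K) - 1)).restrictScalars 𝒪[K]) ≤ scaleLattice (ϖ ^ d₀) w.1 ∧ (w.1.map ((Matrix.toLin' (((γ' : GL (Fin 3) K) : Matrix (Fin 3) (Fin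 3) K) - 1)).restrictScalars 𝒪[K]) ≤ scaleLattice (ϖ ^ (d₀ - 2)) w.1 ∧ ¬ w.1.map ((Matrix.toLin' (((γ' : GL (Fin 3) K) : Matrix (Fin 3) (Fin 3) K) - 1)).restrictScalars 𝒪[K]) ≤ scaleLattice (ϖ ^ (d₀ - 1)) w.1) ∧ ∃ y ∈ w.1, ∃ a : K, Valued.v a = 1 ∧ Valued.v ((ϖ ^ (d₀ - 2))⁻¹ * pairing σ J y ((((γ' : GL (Fin 3) K) : Matrix (Fin 3) (Fin 3) K) - 1) *ᵥ y) - (c₁) * a ^ 2) < 1)}).ncard =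
      ({w | w ∈ {w | ∃ c, ((latticeGraph σ ϖ Hb).Adj rb c ∧ (latticeGraph σ ϖ Hb).dist rb c = (latticeGraph σ ϖ Hb).dist rb rb + 1 ∧ latticeGraphIso σ ϖ Hb Γ c = c) ∧ ((latticeGraph σ ϖ Hb).Adj c w ∧ (latticeGraph σ ϖ Hb).dist rb w = (latticeGraph σ ϖ Hb).dist rb c + 1 ∧ latticeGraphIso σ ϖ Hb Γ w = w)} ∧ (¬ w.1.map ((Matrix.toLin' (((Γ : GL (Fin 3) K) : Matrix (Fin 3) (Fin 3) K) - 1)).restrictScalars 𝒪[K]) ≤ scaleLattice (ϖ ^ d₀) w.1 ∧ (w.1.map ((Matrix.toLin' (((Γ : GL (Fin 3) K) : Matrix (Fin 3) (Fin 3) K) - 1)).restrictScalars 𝒪[K]) ≤ scaleLattice (ϖ ^ (d₀ - 2)) w.1 ∧ ¬ w.1.map ((Matrix.toLin' (((Γ : GL (Fin 3) K) : Matrix (Fin 3) (Fin 3) K) - 1)).restrictScalars 𝒪[K]) ≤ scaleLattice (ϖ ^ (d₀ - 1)) w.1) ∧ ∃ y ∈ w.1, ∃ a : K, Valued.v a =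 1 ∧ Valued.v ((ϖ ^ (d₀ - 2))⁻¹ * pairing σ Hb y ((((Γ : GL (Fin 3) K) : Matrix (Fin 3) (Fin 3) K) - 1) *ᵥ y) - (c₁) * a ^ 2) < 1)}).ncard := by
  refine ncard_rootGrandchildren_sep_eq_of_formCongr J P hHb γ' Γ hγ r rb hr
    (fun M => (¬ M.map ((Matrix.toLin' (((γ' : GL (Fin 3) K) : Matrix (Fin 3) (Fin 3) K) - 1)).restrictScalars 𝒪[K]) ≤ scaleLattice (ϖ ^ d₀) M ∧ (M.map ((Matrix.toLin' (((γ' : GL (Fin 3) K) : Matrix (Fin 3) (Fin 3) K) - 1)).restrictScalars 𝒪[K]) ≤ scaleLattice (ϖ ^ (d₀ - 2)) M ∧ ¬ M.map ((Matrix.toLin' (((γ' : GL (Fin 3) K) : Matrix (Fin 3) (Fin 3) K) - 1)).restrictScalars 𝒪[K]) ≤ scaleLattice (ϖ ^ (d₀ - 1)) M) ∧ ∃ y ∈ M, ∃ a : K, Valued.v a = 1 ∧ Valued.v ((ϖ ^ (d₀ - 2))⁻¹ * pairing σ J y ((((γ' : GL (Fin 3) K) : Matrix (Fin 3) (Fin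 3) K) - 1) *ᵥ y) - (c₁) * a ^ 2) < 1))
    (fun M => (¬ M.map ((Matrix.toLin' (((Γ : GL (Fin 3) K) : Matrix (Fin 3) (Fin 3) K) - 1)).restrictScalars 𝒪[K]) ≤ scaleLattice (ϖ ^ d₀) M ∧ (M.map ((Matrix.toLin' (((Γ : GL (Fin 3) K) : Matrix (Fin 3) (Fin 3) K) - 1)).restrictScalars 𝒪[K]) ≤ scaleLattice (ϖ ^ (d₀ - 2)) M ∧ ¬ M.map ((Matrix.toLin' (((Γ : GL (Fin 3) K) : Matrix (Fin 3) (Fin 3) K) - 1)).restrictScalars 𝒪[K]) ≤ scaleLattice (ϖ ^ (d₀ - 1)) M) ∧ ∃ y ∈ M, ∃ a : K, Valued.v a = 1 ∧ Valued.v ((ϖ ^ (d₀ - 2))⁻¹ * pairing σ Hb y ((((Γ : GL (Fin 3) K) : Matrix (Fin 3) (Fin 3) K) - 1) *ᵥ y) - (c₁) * a ^ 2) < 1)) fun M => ?_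
  subst hHb
  simp only [hγ, map_conj_sub_one_le_scaleLattice_iff, exists_mem_mapGL_class_iff]

/-- The route-B census atom **`M`** (odd root depth `d₀`; the `hNM` binder of ★ p848877 with the label VERBATIM) transports along the frame (§1 with `hQ` from
★ `map_conj_sub_one_le_scaleLattice_iff` ∕ `map_conj_sub_one_sq_le_scaleLattice_iff` ∕ `exists_mem_mapGL_class_iff`). [cite: Kottwitz1986, §3] [cite: BruhatTits1972, §10] -/
theorem ncard_rootGrandchildren_M_eq_of_formCongr (J : Matrix (Fin 3) (Fin 3) K) (P : GL (Fin 3) K) {Hb : Matrix (Fin 3) (Fin 3) K} (hHb : formCongr σ P J = Hb)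
    (γ' : unitaryGroupOfForm σ J) (Γ : unitaryGroupOfForm σ Hb) (hγ : (γ' : GL (Fin 3) K) = P * (Γ : GL (Fin 3) K) * P⁻¹)
    (r : {M : Submodule 𝒪[K] (Fin 3 → K) // IsVertex σ ϖ J M}) (rb : {M : Submodule 𝒪[K] (Fin 3 → K) // IsVertex σ ϖ Hb M}) (hr : r.1 = mapGL P rb.1)
    {d₀ : ℕ} (c₁ : K) :
    ({w | w ∈ {w | ∃ c, ((latticeGraph σ ϖ J).Adj r c ∧ (latticeGraph σ ϖ J).dist r c = (latticeGraph σ ϖ J).dist r r + 1 ∧ latticeGraphIso σ ϖ J γ' c = c) ∧ ((latticeGraph σ ϖ J).Adj c w ∧ (latticeGraph σ ϖ J).dist r w = (latticeGraph σ ϖ J).dist r c + 1 ∧ latticeGraphIso σ ϖ J γ' w = w)} ∧ (¬ w.1.map ((Matrix.toLin' (((γ' : GL (Fin 3) K) : Matrix (Fin 3) (Fin 3) K) - 1)).restrictScalars 𝒪[K]) ≤ scaleLattice (ϖ ^ d₀) w.1 ∧ (w.1.map ((Matrix.toLin' (((γ' : GL (Fin 3) K) : Matrix (Fin 3) (Fin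 3) K) - 1)).restrictScalars 𝒪[K]) ≤ scaleLattice (ϖ ^ (d₀ - 2)) w.1 ∧ ¬ w.1.map ((Matrix.toLin' (((γ' : GL (Fin 3) K) : Matrix (Fin 3) (Fin 3) K) - 1)).restrictScalars 𝒪[K]) ≤ scaleLattice (ϖ ^ (d₀ - 1)) w.1) ∧ ¬ (∃ y ∈ w.1, ∃ a : K, Valued.v a = 1 ∧ Valued.v ((ϖ ^ (d₀ - 2))⁻¹ * pairing σ J y ((((γ' : GL (Fin 3) K) : Matrix (Fin 3) (Fin 3) K) - 1) *ᵥ y) - (c₁) * a ^ 2) < 1))}).ncard =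
      ({w | w ∈ {w | ∃ c, ((latticeGraph σ ϖ Hb).Adj rb c ∧ (latticeGraph σ ϖ Hb).dist rb c = (latticeGraph σ ϖ Hb).dist rb rb + 1 ∧ latticeGraphIso σ ϖ Hb Γ c = c) ∧ ((latticeGraph σ ϖ Hb).Adj c w ∧ (latticeGraph σ ϖ Hb).dist rb w = (latticeGraph σ ϖ Hb).dist rb c + 1 ∧ latticeGraphIso σ ϖ Hb Γ w = w)} ∧ (¬ w.1.map ((Matrix.toLin' (((Γ : GL (Fin 3) K) : Matrix (Fin 3) (Fin 3) K) - 1)).restrictScalars 𝒪[K]) ≤ scaleLattice (ϖ ^ d₀) w.1 ∧ (w.1.map ((Matrix.toLin' (((Γ : GL (Fin 3) K) : Matrix (Fin 3) (Fin 3) K) - 1)).restrictScalars 𝒪[K]) ≤ scaleLattice (ϖ ^ (d₀ - 2)) w.1 ∧ ¬ w.1.map ((Matrix.toLin' (((Γ : GL (Fin 3) K) : Matrix (Fin 3) (Fin 3) K) - 1)).restrictScalars 𝒪[K]) ≤ scaleLattice (ϖ ^ (d₀ - 1)) w.1) ∧ ¬ (∃ y ∈ w.1, ∃ a : K, Valued.v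 a = 1 ∧ Valued.v ((ϖ ^ (d₀ - 2))⁻¹ * pairing σ Hb y ((((Γ : GL (Fin 3) K) : Matrix (Fin 3) (Fin 3) K) - 1) *ᵥ y) - (c₁) * a ^ 2) < 1))}).ncard := by
  refine ncard_rootGrandchildren_sep_eq_of_formCongr J P hHb γ' Γ hγ r rb hr
    (fun M => (¬ M.map ((Matrix.toLin' (((γ' : GL (Fin 3) K) : Matrix (Fin 3) (Fin 3) K) - 1)).restrictScalars 𝒪[K]) ≤ scaleLattice (ϖ ^ d₀) M ∧ (M.map ((Matrix.toLin' (((γ' : GL (Fin 3) K) : Matrix (Fin 3) (Fin 3) K) - 1)).restrictScalars 𝒪[K]) ≤ scaleLattice (ϖ ^ (d₀ - 2)) M ∧ ¬ M.map ((Matrix.toLin' (((γ' : GL (Fin 3) K) : Matrix (Fin 3) (Fin 3) K) - 1)).restrictScalars 𝒪[K]) ≤ scaleLattice (ϖ ^ (d₀ - 1)) M) ∧ ¬ (∃ y ∈ M, ∃ a : K, Valued.v a = 1 ∧ Valued.v ((ϖ ^ (d₀ - 2))⁻¹ * pairing σ J y ((((γ' : GL (Fin 3) K) : Matrix (Fin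 3) (Fin 3) K) - 1) *ᵥ y) - (c₁) * a ^ 2) < 1)))
    (fun M => (¬ M.map ((Matrix.toLin' (((Γ : GL (Fin 3) K) : Matrix (Fin 3) (Fin 3) K) - 1)).restrictScalars 𝒪[K]) ≤ scaleLattice (ϖ ^ d₀) M ∧ (M.map ((Matrix.toLin' (((Γ : GL (Fin 3) K) : Matrix (Fin 3) (Fin 3) K) - 1)).restrictScalars 𝒪[K]) ≤ scaleLattice (ϖ ^ (d₀ - 2)) M ∧ ¬ M.map ((Matrix.toLin' (((Γ : GL (Fin 3) K) : Matrix (Fin 3) (Fin 3) K) - 1)).restrictScalars 𝒪[K]) ≤ scaleLattice (ϖ ^ (d₀ - 1)) M) ∧ ¬ (∃ y ∈ M, ∃ a : K, Valued.v a = 1 ∧ Valued.v ((ϖ ^ (d₀ - 2))⁻¹ * pairing σ Hb y ((((Γ : GL (Fin 3) K) : Matrix (Fin 3) (Fin 3) K) - 1) *ᵥ y) - (c₁) * a ^ 2) < 1))) fun M => ?_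
  subst hHb
  simp only [hγ, map_conj_sub_one_le_scaleLattice_iff, exists_mem_mapGL_class_iff]

/-- The route-B census atom **`Eeven`** (even root depth `d₀`; the `hNE` binder of ★ p848995 with the label VERBATIM) transports along the frame (§1 with `hQ` from
★ `map_conj_sub_one_le_scaleLattice_iff` ∕ `map_conj_sub_one_sq_le_scaleLattice_iff` ∕ `exists_mem_mapGL_class_iff`). [cite: Kottwitz1986, §3] [cite: BruhatTits1972, §10] -/
theorem ncard_rootGrandchildren_Eeven_eq_of_formCongr (J : Matrix (Fin 3) (Fin 3) K) (P : GL (Fin 3) K) {Hb : Matrix (Fin 3) (Fin 3) K} (hHb : formCongr σ P J = Hb)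
    (γ' : unitaryGroupOfForm σ J) (Γ : unitaryGroupOfForm σ Hb) (hγ : (γ' : GL (Fin 3) K) = P * (Γ : GL (Fin 3) K) * P⁻¹)
    (r : {M : Submodule 𝒪[K] (Fin 3 → K) // IsVertex σ ϖ J M}) (rb : {M : Submodule 𝒪[K] (Fin 3 → K) // IsVertex σ ϖ Hb M}) (hr : r.1 = mapGL P rb.1)
    {d₀ : ℕ} :
    ({w | w ∈ {w | ∃ c, ((latticeGraph σ ϖ J).Adj r c ∧ (latticeGraph σ ϖ J).dist r c = (latticeGraph σ ϖ J).dist r r + 1 ∧ latticeGraphIso σ ϖ J γ' c = c) ∧ ((latticeGraph σ ϖ J).Adj c w ∧ (latticeGraph σ ϖ J).dist r w = (latticeGraph σ ϖ J).dist r c + 1 ∧ latticeGraphIso σ ϖ J γ' w = w)} ∧ (¬ w.1.map ((Matrix.toLin' (((γ' : GL (Fin 3) K) : Matrix (Fin 3) (Fin 3) K) - 1)).restrictScalars 𝒪[K]) ≤ scaleLattice (ϖ ^ d₀) w.1 ∧ (w.1.map ((Matrix.toLin' (((γ' : GL (Fin 3) K) : Matrix (Fin 3) (Fin 3) K) - 1)).restrictScalars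 𝒪[K]) ≤ scaleLattice (ϖ ^ (d₀ - 2)) w.1 ∧ ¬ w.1.map ((Matrix.toLin' (((γ' : GL (Fin 3) K) : Matrix (Fin 3) (Fin 3) K) - 1)).restrictScalars 𝒪[K]) ≤ scaleLattice (ϖ ^ (d₀ - 1)) w.1))}).ncard =
      ({w | w ∈ {w | ∃ c, ((latticeGraph σ ϖ Hb).Adj rb c ∧ (latticeGraph σ ϖ Hb).dist rb c = (latticeGraph σ ϖ Hb).dist rb rb + 1 ∧ latticeGraphIso σ ϖ Hb Γ c = c) ∧ ((latticeGraph σ ϖ Hb).Adj c w ∧ (latticeGraph σ ϖ Hb).dist rb w = (latticeGraph σ ϖ Hb).dist rb c + 1 ∧ latticeGraphIso σ ϖ Hb Γ w = w)} ∧ (¬ w.1.map ((Matrix.toLin' (((Γ : GL (Fin 3) K) : Matrix (Fin 3) (Fin 3) K) - 1)).restrictScalars 𝒪[K]) ≤ scaleLattice (ϖ ^ d₀) w.1 ∧ (w.1.map ((Matrix.toLin' (((Γ : GL (Fin 3) K) : Matrix (Fin 3) (Fin 3) K) - 1)).restrictScalars 𝒪[K]) ≤ scaleLattice (ϖ ^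 (d₀ - 2)) w.1 ∧ ¬ w.1.map ((Matrix.toLin' (((Γ : GL (Fin 3) K) : Matrix (Fin 3) (Fin 3) K) - 1)).restrictScalars 𝒪[K]) ≤ scaleLattice (ϖ ^ (d₀ - 1)) w.1))}).ncard := by
  refine ncard_rootGrandchildren_sep_eq_of_formCongr J P hHb γ' Γ hγ r rb hr
    (fun M => (¬ M.map ((Matrix.toLin' (((γ' : GL (Fin 3) K) : Matrix (Fin 3) (Fin 3) K) - 1)).restrictScalars 𝒪[K]) ≤ scaleLattice (ϖ ^ d₀) M ∧ (M.map ((Matrix.toLin' (((γ' : GL (Fin 3) K) : Matrix (Fin 3) (Fin 3) K) - 1)).restrictScalars 𝒪[K]) ≤ scaleLattice (ϖ ^ (d₀ - 2)) M ∧ ¬ M.map ((Matrix.toLin' (((γ' : GL (Fin 3) K) : Matrix (Fin 3) (Fin 3) K) - 1)).restrictScalars 𝒪[K]) ≤ scaleLattice (ϖ ^ (d₀ - 1)) M)))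
    (fun M => (¬ M.map ((Matrix.toLin' (((Γ : GL (Fin 3) K) : Matrix (Fin 3) (Fin 3) K) - 1)).restrictScalars 𝒪[K]) ≤ scaleLattice (ϖ ^ d₀) M ∧ (M.map ((Matrix.toLin' (((Γ : GL (Fin 3) K) : Matrix (Fin 3) (Fin 3) K) - 1)).restrictScalars 𝒪[K]) ≤ scaleLattice (ϖ ^ (d₀ - 2)) M ∧ ¬ M.map ((Matrix.toLin' (((Γ : GL (Fin 3) K) : Matrix (Fin 3) (Fin 3) K) - 1)).restrictScalars 𝒪[K]) ≤ scaleLattice (ϖ ^ (d₀ - 1)) M))) fun M => ?_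
  subst hHb
  simp only [hγ, map_conj_sub_one_le_scaleLattice_iff]

/-- The route-B census atom **`O`** (even root depth `d₀`; the `hNO` binder of ★ p848995 with the label VERBATIM) transports along the frame (§1 with `hQ` from
★ `map_conj_sub_one_le_scaleLattice_iff` ∕ `map_conj_sub_one_sq_le_scaleLattice_iff` ∕ `exists_mem_mapGL_class_iff`). [cite: Kottwitz1986, §3] [cite: BruhatTits1972, §10] -/
theorem ncard_rootGrandchildren_O_eq_of_formCongr (J : Matrix (Fin 3) (Fin 3) K) (P : GL (Fin 3) K) {Hb : Matrix (Fin 3) (Fin 3) K} (hHb : formCongr σ P J = Hb)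
    (γ' : unitaryGroupOfForm σ J) (Γ : unitaryGroupOfForm σ Hb) (hγ : (γ' : GL (Fin 3) K) = P * (Γ : GL (Fin 3) K) * P⁻¹)
    (r : {M : Submodule 𝒪[K] (Fin 3 → K) // IsVertex σ ϖ J M}) (rb : {M : Submodule 𝒪[K] (Fin 3 → K) // IsVertex σ ϖ Hb M}) (hr : r.1 = mapGL P rb.1)
    {d₀ : ℕ} :
    ({w | w ∈ {w | ∃ c, ((latticeGraph σ ϖ J).Adj r c ∧ (latticeGraph σ ϖ J).dist r c = (latticeGraph σ ϖ J).dist r r + 1 ∧ latticeGraphIso σ ϖ J γ' c = c) ∧ ((latticeGraph σ ϖ J).Adj c w ∧ (latticeGraph σ ϖ J).dist r w = (latticeGraph σ ϖ J).dist r c + 1 ∧ latticeGraphIso σ ϖ J γ' w = w)} ∧ (¬ w.1.map ((Matrix.toLin' (((γ' : GL (Fin 3) K) : Matrix (Fin 3) (Fin 3) K) - 1)).restrictScalars 𝒪[K]) ≤ scaleLattice (ϖ ^ d₀) w.1 ∧ (w.1.map ((Matrix.toLin' (((γ' : GL (Fin 3) K) : Matrix (Fin 3) (Fin 3) K) - 1)).restrictScalars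 𝒪[K]) ≤ scaleLattice (ϖ ^ (d₀ - 1)) w.1 ∧ ¬ w.1.map ((Matrix.toLin' (((γ' : GL (Fin 3) K) : Matrix (Fin 3) (Fin 3) K) - 1)).restrictScalars 𝒪[K]) ≤ scaleLattice (ϖ ^ d₀) w.1) ∧ ¬ w.1.map ((Matrix.toLin' ((((γ' : GL (Fin 3) K) : Matrix (Fin 3) (Fin 3) K) - 1) ^ 2)).restrictScalars 𝒪[K]) ≤ scaleLattice (ϖ ^ (2 * d₀ - 1)) w.1)}).ncard =
      ({w | w ∈ {w | ∃ c, ((latticeGraph σ ϖ Hb).Adj rb c ∧ (latticeGraph σ ϖ Hb).dist rb c = (latticeGraph σ ϖ Hb).dist rb rb + 1 ∧ latticeGraphIso σ ϖ Hb Γ c = c) ∧ ((latticeGraph σ ϖ Hb).Adj c w ∧ (latticeGraph σ ϖ Hb).dist rb w = (latticeGraph σ ϖ Hb).dist rb c + 1 ∧ latticeGraphIso σ ϖ Hb Γ w = w)} ∧ (¬ w.1.map ((Matrix.toLin' (((Γ : GL (Fin 3) K) : Matrix (Fin 3) (Fin 3) K) - 1)).restrictScalars 𝒪[K]) ≤ scaleLattice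 (ϖ ^ d₀) w.1 ∧ (w.1.map ((Matrix.toLin' (((Γ : GL (Fin 3) K) : Matrix (Fin 3) (Fin 3) K) - 1)).restrictScalars 𝒪[K]) ≤ scaleLattice (ϖ ^ (d₀ - 1)) w.1 ∧ ¬ w.1.map ((Matrix.toLin' (((Γ : GL (Fin 3) K) : Matrix (Fin 3) (Fin 3) K) - 1)).restrictScalars 𝒪[K]) ≤ scaleLattice (ϖ ^ d₀) w.1) ∧ ¬ w.1.map ((Matrix.toLin' ((((Γ : GL (Fin 3) K) : Matrix (Fin 3) (Fin 3) K) - 1) ^ 2)).restrictScalars 𝒪[K]) ≤ scaleLattice (ϖ ^ (2 * d₀ - 1)) w.1)}).ncard := by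
  refine ncard_rootGrandchildren_sep_eq_of_formCongr J P hHb γ' Γ hγ r rb hr
    (fun M => (¬ M.map ((Matrix.toLin' (((γ' : GL (Fin 3) K) : Matrix (Fin 3) (Fin 3) K) - 1)).restrictScalars 𝒪[K]) ≤ scaleLattice (ϖ ^ d₀) M ∧ (M.map ((Matrix.toLin' (((γ' : GL (Fin 3) K) : Matrix (Fin 3) (Fin 3) K) - 1)).restrictScalars 𝒪[K]) ≤ scaleLattice (ϖ ^ (d₀ - 1)) M ∧ ¬ M.map ((Matrix.toLin' (((γ' : GL (Fin 3) K) : Matrix (Fin 3) (Fin 3) K) - 1)).restrictScalars 𝒪[K]) ≤ scaleLattice (ϖ ^ d₀) M) ∧ ¬ M.map ((Matrix.toLin' ((((γ' : GL (Fin 3) K) : Matrix (Fin 3) (Fin 3) K) - 1) ^ 2)).restrictScalars 𝒪[K]) ≤ scaleLattice (ϖ ^ (2 * d₀ - 1)) M))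
    (fun M => (¬ M.map ((Matrix.toLin' (((Γ : GL (Fin 3) K) : Matrix (Fin 3) (Fin 3) K) - 1)).restrictScalars 𝒪[K]) ≤ scaleLattice (ϖ ^ d₀) M ∧ (M.map ((Matrix.toLin' (((Γ : GL (Fin 3) K) : Matrix (Fin 3) (Fin 3) K) - 1)).restrictScalars 𝒪[K]) ≤ scaleLattice (ϖ ^ (d₀ - 1)) M ∧ ¬ M.map ((Matrix.toLin' (((Γ : GL (Fin 3) K) : Matrix (Fin 3) (Fin 3) K) - 1)).restrictScalars 𝒪[K]) ≤ scaleLattice (ϖ ^ d₀) M) ∧ ¬ M.map ((Matrix.toLin' ((((Γ : GL (Fin 3) K) : Matrix (Fin 3) (Fin 3) K) - 1) ^ 2)).restrictScalars 𝒪[K]) ≤ scaleLattice (ϖ ^ (2 * d₀ - 1)) M)) fun M => ?_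
  subst hHb
  simp only [hγ, map_conj_sub_one_le_scaleLattice_iff, map_conj_sub_one_sq_le_scaleLattice_iff]

/-- The route-B census atom **`Peven`** (even root depth `d₀`; the `hNP` binder of ★ p848995 with the label VERBATIM) transports along the frame (§1 with `hQ` from
★ `map_conj_sub_one_le_scaleLattice_iff` ∕ `map_conj_sub_one_sq_le_scaleLattice_iff` ∕ `exists_mem_mapGL_class_iff`). [cite: Kottwitz1986, §3] [cite: BruhatTits1972, §10] -/
theorem ncard_rootGrandchildren_Peven_eq_of_formCongr (J : Matrix (Fin 3) (Fin 3) K) (P : GL (Fin 3) K) {Hb : Matrix (Fin 3) (Fin 3) K} (hHb : formCongr σ P J = Hb)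
    (γ' : unitaryGroupOfForm σ J) (Γ : unitaryGroupOfForm σ Hb) (hγ : (γ' : GL (Fin 3) K) = P * (Γ : GL (Fin 3) K) * P⁻¹)
    (r : {M : Submodule 𝒪[K] (Fin 3 → K) // IsVertex σ ϖ J M}) (rb : {M : Submodule 𝒪[K] (Fin 3 → K) // IsVertex σ ϖ Hb M}) (hr : r.1 = mapGL P rb.1)
    {d₀ : ℕ} (c₁ : K) :
    ({w | w ∈ {w | ∃ c, ((latticeGraph σ ϖ J).Adj r c ∧ (latticeGraph σ ϖ J).dist r c = (latticeGraph σ ϖ J).dist r r + 1 ∧ latticeGraphIso σ ϖ J γ' c = c) ∧ ((latticeGraph σ ϖ J).Adj c w ∧ (latticeGraph σ ϖ J).dist r w = (latticeGraph σ ϖ J).dist r c + 1 ∧ latticeGraphIso σ ϖ J γ' w = w)} ∧ (¬ w.1.map ((Matrix.toLin' (((γ' : GL (Fin 3) K) : Matrix (Fin 3) (Fin 3) K) - 1)).restrictScalars 𝒪[K]) ≤ scaleLattice (ϖ ^ d₀) w.1 ∧ (w.1.map ((Matrix.toLin' (((γ' : GL (Fin 3) K) : Matrix (Fin 3) (Fin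 3) K) - 1)).restrictScalars 𝒪[K]) ≤ scaleLattice (ϖ ^ (d₀ - 1)) w.1 ∧ ¬ w.1.map ((Matrix.toLin' (((γ' : GL (Fin 3) K) : Matrix (Fin 3) (Fin 3) K) - 1)).restrictScalars 𝒪[K]) ≤ scaleLattice (ϖ ^ d₀) w.1) ∧ w.1.map ((Matrix.toLin' ((((γ' : GL (Fin 3) K) : Matrix (Fin 3) (Fin 3) K) - 1) ^ 2)).restrictScalars 𝒪[K]) ≤ scaleLattice (ϖ ^ (2 * d₀ - 1)) w.1 ∧ ∃ y ∈ w.1, ∃ a : K, Valued.v a = 1 ∧ Valued.v ((ϖ ^ (d₀ - 1))⁻¹ * pairing σ J y ((((γ' : GL (Fin 3) K) : Matrix (Fin 3) (Fin 3) K) - 1) *ᵥ y) - (c₁) * a ^ 2) < 1)}).ncard =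
      ({w | w ∈ {w | ∃ c, ((latticeGraph σ ϖ Hb).Adj rb c ∧ (latticeGraph σ ϖ Hb).dist rb c = (latticeGraph σ ϖ Hb).dist rb rb + 1 ∧ latticeGraphIso σ ϖ Hb Γ c = c) ∧ ((latticeGraph σ ϖ Hb).Adj c w ∧ (latticeGraph σ ϖ Hb).dist rb w = (latticeGraph σ ϖ Hb).dist rb c + 1 ∧ latticeGraphIso σ ϖ Hb Γ w = w)} ∧ (¬ w.1.map ((Matrix.toLin' (((Γ : GL (Fin 3) K) : Matrix (Fin 3) (Fin 3) K) - 1)).restrictScalars 𝒪[K]) ≤ scaleLattice (ϖ ^ d₀) w.1 ∧ (w.1.map ((Matrix.toLin' (((Γ : GL (Fin 3) K) : Matrix (Fin 3) (Fin 3) K) - 1)).restrictScalars 𝒪[K]) ≤ scaleLattice (ϖ ^ (d₀ - 1)) w.1 ∧ ¬ w.1.map ((Matrix.toLin' (((Γ : GL (Fin 3) K) : Matrix (Fin 3) (Fin 3) K) - 1)).restrictScalars 𝒪[K]) ≤ scaleLattice (ϖ ^ d₀) w.1) ∧ w.1.map ((Matrix.toLin' ((((Γ : GL (Fin 3) K)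 : Matrix (Fin 3) (Fin 3) K) - 1) ^ 2)).restrictScalars 𝒪[K]) ≤ scaleLattice (ϖ ^ (2 * d₀ - 1)) w.1 ∧ ∃ y ∈ w.1, ∃ a : K, Valued.v a = 1 ∧ Valued.v ((ϖ ^ (d₀ - 1))⁻¹ * pairing σ Hb y ((((Γ : GL (Fin 3) K) : Matrix (Fin 3) (Fin 3) K) - 1) *ᵥ y) - (c₁) * a ^ 2) < 1)}).ncard := by
  refine ncard_rootGrandchildren_sep_eq_of_formCongr J P hHb γ' Γ hγ r rb hr
    (fun M => (¬ M.map ((Matrix.toLin' (((γ' : GL (Fin 3) K) : Matrix (Fin 3) (Fin 3) K) - 1)).restrictScalars 𝒪[K]) ≤ scaleLattice (ϖ ^ d₀) M ∧ (M.map ((Matrix.toLin' (((γ' : GL (Fin 3) K) : Matrix (Fin 3) (Fin 3) K) - 1)).restrictScalars 𝒪[K]) ≤ scaleLattice (ϖ ^ (d₀ - 1)) M ∧ ¬ M.map ((Matrix.toLin' (((γ' : GL (Fin 3) K) : Matrix (Fin 3) (Fin 3) K) - 1)).restrictScalars 𝒪[K]) ≤ scaleLattice (ϖ ^ d₀) M)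 ∧ M.map ((Matrix.toLin' ((((γ' : GL (Fin 3) K) : Matrix (Fin 3) (Fin 3) K) - 1) ^ 2)).restrictScalars 𝒪[K]) ≤ scaleLattice (ϖ ^ (2 * d₀ - 1)) M ∧ ∃ y ∈ M, ∃ a : K, Valued.v a = 1 ∧ Valued.v ((ϖ ^ (d₀ - 1))⁻¹ * pairing σ J y ((((γ' : GL (Fin 3) K) : Matrix (Fin 3) (Fin 3) K) - 1) *ᵥ y) - (c₁) * a ^ 2) < 1))
    (fun M => (¬ M.map ((Matrix.toLin' (((Γ : GL (Fin 3) K) : Matrix (Fin 3) (Fin 3) K) - 1)).restrictScalars 𝒪[K]) ≤ scaleLattice (ϖ ^ d₀) M ∧ (M.map ((Matrix.toLin' (((Γ : GL (Fin 3) K) : Matrix (Fin 3) (Fin 3) K) - 1)).restrictScalars 𝒪[K]) ≤ scaleLattice (ϖ ^ (d₀ - 1)) M ∧ ¬ M.map ((Matrix.toLin' (((Γ : GL (Fin 3) K) : Matrix (Fin 3) (Fin 3) K) - 1)).restrictScalars 𝒪[K]) ≤ scaleLattice (ϖ ^ d₀) M) ∧ M.map ((Matrix.toLin' ((((Γ :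 GL (Fin 3) K) : Matrix (Fin 3) (Fin 3) K) - 1) ^ 2)).restrictScalars 𝒪[K]) ≤ scaleLattice (ϖ ^ (2 * d₀ - 1)) M ∧ ∃ y ∈ M, ∃ a : K, Valued.v a = 1 ∧ Valued.v ((ϖ ^ (d₀ - 1))⁻¹ * pairing σ Hb y ((((Γ : GL (Fin 3) K) : Matrix (Fin 3) (Fin 3) K) - 1) *ᵥ y) - (c₁) * a ^ 2) < 1)) fun M => ?_
  subst hHb
  simp only [hγ, map_conj_sub_one_le_scaleLattice_iff, map_conj_sub_one_sq_le_scaleLattice_iff, exists_mem_mapGL_class_iff]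

/-- The route-B census atom **`Meven`** (even root depth `d₀`; the `hNM` binder of ★ p848995 with the label VERBATIM) transports along the frame (§1 with `hQ` from
★ `map_conj_sub_one_le_scaleLattice_iff` ∕ `map_conj_sub_one_sq_le_scaleLattice_iff` ∕ `exists_mem_mapGL_class_iff`). [cite: Kottwitz1986, §3] [cite: BruhatTits1972, §10] -/
theorem ncard_rootGrandchildren_Meven_eq_of_formCongr (J : Matrix (Fin 3) (Fin 3) K) (P : GL (Fin 3) K) {Hb : Matrix (Fin 3) (Fin 3) K} (hHb : formCongr σ P J = Hb)
    (γ' : unitaryGroupOfForm σ J) (Γ : unitaryGroupOfForm σ Hb) (hγ : (γ' : GL (Fin 3) K) = P * (Γ : GL (Fin 3) K) * P⁻¹)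
    (r : {M : Submodule 𝒪[K] (Fin 3 → K) // IsVertex σ ϖ J M}) (rb : {M : Submodule 𝒪[K] (Fin 3 → K) // IsVertex σ ϖ Hb M}) (hr : r.1 = mapGL P rb.1)
    {d₀ : ℕ} (c₁ : K) :
    ({w | w ∈ {w | ∃ c, ((latticeGraph σ ϖ J).Adj r c ∧ (latticeGraph σ ϖ J).dist r c = (latticeGraph σ ϖ J).dist r r + 1 ∧ latticeGraphIso σ ϖ J γ' c = c) ∧ ((latticeGraph σ ϖ J).Adj c w ∧ (latticeGraph σ ϖ J).dist r w = (latticeGraph σ ϖ J).dist r c + 1 ∧ latticeGraphIso σ ϖ J γ' w = w)} ∧ (¬ w.1.map ((Matrix.toLin' (((γ' : GL (Fin 3) K) : Matrix (Fin 3) (Fin 3) K) - 1)).restrictScalars 𝒪[K]) ≤ scaleLattice (ϖ ^ d₀) w.1 ∧ (w.1.map ((Matrix.toLin' (((γ' : GL (Fin 3) K) : Matrix (Fin 3) (Fin 3) K) - 1)).restrictScalars 𝒪[K]) ≤ scaleLattice (ϖ ^ (d₀ - 1)) w.1 ∧ ¬ w.1.map ((Matrix.toLin' (((γ' : GL (Fin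 3) K) : Matrix (Fin 3) (Fin 3) K) - 1)).restrictScalars 𝒪[K]) ≤ scaleLattice (ϖ ^ d₀) w.1) ∧ w.1.map ((Matrix.toLin' ((((γ' : GL (Fin 3) K) : Matrix (Fin 3) (Fin 3) K) - 1) ^ 2)).restrictScalars 𝒪[K]) ≤ scaleLattice (ϖ ^ (2 * d₀ - 1)) w.1 ∧ ¬ (∃ y ∈ w.1, ∃ a : K, Valued.v a = 1 ∧ Valued.v ((ϖ ^ (d₀ - 1))⁻¹ * pairing σ J y ((((γ' : GL (Fin 3) K) : Matrix (Fin 3) (Fin 3) K) - 1) *ᵥ y) - (c₁) * a ^ 2) < 1))}).ncard =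
      ({w | w ∈ {w | ∃ c, ((latticeGraph σ ϖ Hb).Adj rb c ∧ (latticeGraph σ ϖ Hb).dist rb c = (latticeGraph σ ϖ Hb).dist rb rb + 1 ∧ latticeGraphIso σ ϖ Hb Γ c = c) ∧ ((latticeGraph σ ϖ Hb).Adj c w ∧ (latticeGraph σ ϖ Hb).dist rb w = (latticeGraph σ ϖ Hb).dist rb c + 1 ∧ latticeGraphIso σ ϖ Hb Γ w = w)} ∧ (¬ w.1.map ((Matrix.toLin' (((Γ : GL (Fin 3) K) : Matrix (Fin 3) (Fin 3) K) - 1)).restrictScalars 𝒪[K]) ≤ scaleLattice (ϖ ^ d₀) w.1 ∧ (w.1.map ((Matrix.toLin' (((Γ : GL (Fin 3) K) : Matrix (Fin 3) (Fin 3) K) - 1)).restrictScalars 𝒪[K]) ≤ scaleLattice (ϖ ^ (d₀ - 1)) w.1 ∧ ¬ w.1.map ((Matrix.toLin' (((Γ : GL (Fin 3) K) : Matrix (Fin 3) (Fin 3) K) - 1)).restrictScalars 𝒪[K]) ≤ scaleLattice (ϖ ^ d₀) w.1) ∧ w.1.map ((Matrix.toLin' ((((Γ : GL (Fin 3) K)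 : Matrix (Fin 3) (Fin 3) K) - 1) ^ 2)).restrictScalars 𝒪[K]) ≤ scaleLattice (ϖ ^ (2 * d₀ - 1)) w.1 ∧ ¬ (∃ y ∈ w.1, ∃ a : K, Valued.v a = 1 ∧ Valued.v ((ϖ ^ (d₀ - 1))⁻¹ * pairing σ Hb y ((((Γ : GL (Fin 3) K) : Matrix (Fin 3) (Fin 3) K) - 1) *ᵥ y) - (c₁) * a ^ 2) < 1))}).ncard := by
  refine ncard_rootGrandchildren_sep_eq_of_formCongr J P hHb γ' Γ hγ r rb hr
    (fun M => (¬ M.map ((Matrix.toLin' (((γ' : GL (Fin 3) K) : Matrix (Fin 3) (Fin 3) K) - 1)).restrictScalars 𝒪[K]) ≤ scaleLattice (ϖ ^ d₀) M ∧ (M.map ((Matrix.toLin' (((γ' : GL (Fin 3) K) : Matrix (Fin 3) (Fin 3) K) - 1)).restrictScalars 𝒪[K]) ≤ scaleLattice (ϖ ^ (d₀ - 1)) M ∧ ¬ M.map ((Matrix.toLin' (((γ' : GL (Fin 3) K) : Matrix (Fin 3) (Fin 3) K) - 1)).restrictScalars 𝒪[K]) ≤ scaleLattice (ϖ ^ d₀)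 M) ∧ M.map ((Matrix.toLin' ((((γ' : GL (Fin 3) K) : Matrix (Fin 3) (Fin 3) K) - 1) ^ 2)).restrictScalars 𝒪[K]) ≤ scaleLattice (ϖ ^ (2 * d₀ - 1)) M ∧ ¬ (∃ y ∈ M, ∃ a : K, Valued.v a = 1 ∧ Valued.v ((ϖ ^ (d₀ - 1))⁻¹ * pairing σ J y ((((γ' : GL (Fin 3) K) : Matrix (Fin 3) (Fin 3) K) - 1) *ᵥ y) - (c₁) * a ^ 2) < 1)))
    (fun M => (¬ M.map ((Matrix.toLin' (((Γ : GL (Fin 3) K) : Matrix (Fin 3) (Fin 3) K) - 1)).restrictScalars 𝒪[K]) ≤ scaleLattice (ϖ ^ d₀) M ∧ (M.map ((Matrix.toLin' (((Γ : GL (Fin 3) K) : Matrix (Fin 3) (Fin 3) K) - 1)).restrictScalars 𝒪[K]) ≤ scaleLattice (ϖ ^ (d₀ - 1)) M ∧ ¬ M.map ((Matrix.toLin' (((Γ : GL (Fin 3) K) : Matrix (Fin 3) (Fin 3) K) - 1)).restrictScalars 𝒪[K]) ≤ scaleLattice (ϖ ^ d₀) M) ∧ M.map ((Matrix.toLin'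 ((((Γ : GL (Fin 3) K) : Matrix (Fin 3) (Fin 3) K) - 1) ^ 2)).restrictScalars 𝒪[K]) ≤ scaleLattice (ϖ ^ (2 * d₀ - 1)) M ∧ ¬ (∃ y ∈ M, ∃ a : K, Valued.v a = 1 ∧ Valued.v ((ϖ ^ (d₀ - 1))⁻¹ * pairing σ Hb y ((((Γ : GL (Fin 3) K) : Matrix (Fin 3) (Fin 3) K) - 1) *ᵥ y) - (c₁) * a ^ 2) < 1))) fun M => ?_
  subst hHb
  simp only [hγ, map_conj_sub_one_le_scaleLattice_iff, map_conj_sub_one_sq_le_scaleLattice_iff, exists_mem_mapGL_class_iff]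

end Literature.NumberTheory.Automorphic.UnitaryLatticeTree

end
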